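import Summits.QuantumFields.YangMills.Theorems.BalabanUVNodesN27AtKernelPinnedReading13CoPHLoosePin
import Summits.QuantumFields.YangMills.Theorems.BalabanUVNodesSpineReadingOfRecord13CoPHV
import Summits.QuantumFields.YangMills.Theorems.BalabanUVNodesN15PairedFamilyGuard
import Summits.QuantumFields.YangMills.Theorems.BalabanUVNodesN18U3TowerGuards
import Summits.QuantumFields.YangMills.Theses.BalabanUVNodes

/-!
# K3⁷ v5 — THE TWO REGISTERED STUB TEXTS' PREDICATES AS TREE DEFINITIONS (so that stub proofs and their suppliers can be filed BY NAME), the `Iff.rfl` bridges, the by-name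
# composition, and THE KERNEL-PINNED BILL OF STUB 1's RATES CONJUNCT IN THOSE NAMES

Cell `pub-ymgap` (HUMAN RULING D-0062 Track A; director-ym №197 ∕ HUMAN RULING D-0149), WIDTH SEAT `pub-ymgap-dag-n27-w1` (gen 2) on NODE n27 (B5 composite).
`--kind definition --supports stmt-QuantumFields-20544 --as helper` (count-neutral).  Precedent and pattern: dag-n24-w1's `Thm/BalabanUVNodesK1V6Defs.lean` (K1⁷ v6) and
k0-s2-w1's `Thm/BalabanUVNodesK0V19Defs.lean` (K0⁷ V19); plan g82 «A by-name mirror `Thm/…K3V5Defs.lean` is WELCOME from any K3 lane» (YMPLAN-G82-K3V5-REGISTERED l.28564),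
dag-lead GATE v1.59 (word to this seat by DEDUP-378).  [I] = [Balaban1987RG1]; [II] = [Balaban1988RG2Cluster]; [III] = [Balaban1988Convergent].

WHY.  Plan g82 registered skeleton v5 941dddb108cbaacf on K3⁷ stmt-QuantumFields-20544 (`HOME/pub-ymgap-plan/D82-K3V5/K3Skeleton13SepCoPHv5.lean`, ns
`…Theses.BalabanUVNodes.K3Skeleton13SepCoPHV5`, 2026-08-28 03:59:50Z): stubs `stub_rates13H : ∃ β, 2/3 < β ∧ β < 1 ∧ ∃ 𝔯 ksel ℓ ℓ₃ g B, GuardedReadingN16 𝔯 ksel ℓ ℓ₃ g B ∧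
KeyedRatesHolderD4 β (rrOfRecord 𝔯 ksel)` and `stub_expansion13H : ∀ β …, GuardedReadingN16 … → KeyedRatesHolderD4 … → ∃ jc sh cr, PinnedAtLive jc sh cr ∧ KeyedRelWeight cr ∧
KeyedShellWeight cr ∧ KeyedExtraction cr ∧ KeyedCoreEdgeHolderD4 β cr (rrOfRecord 𝔯 ksel)`.  The gate credits a `--supports 20544` proof only if it proves a registered stub BY NAME with
that VERBATIM header; the predicates are `def`s LOCAL to the skeleton (plan's HOME, never imported — the tree stays sorry-free), so no tree file can spell `GuardedReadingN16 …` or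
`KeyedRatesHolderD4 …`.  THIS FILE puts the v5 §1 ∕ §1b ∕ §1c texts into the tree BYTE-FOR-BYTE (docstrings abridged from the skeleton's), for every K3⁷ lane to import: stub 1 =
the N14 ∕ N15 ∕ N16 ∕ N18 ∕ N22 lanes + def-W1's kernel letters + dag-n14-w1 ∕ dag-n15-a ∕ dag-n16-e∕w1's pins; stub 2 = dag-n20-d ∕ n20-w∗ ∕ n21-∗ ∕ n19-∗ at the spine reading of record.
§2 gives the `Iff.rfl` bridge to the route decl and composes K3⁷ BY NAME from the two texts exactly as the skeleton's `SpineGivenEndpointR13SepCoPH_of` ∕ `_proof` do (dag-n19-w3's FSC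
composer `keyedGuarded₁₃CoPH_of_keyedFacesP_fsc`, p595910).  §3 is THIS SEAT's kernel-pinned bill in the mirrored names: GIVEN the four PINS of `GuardedReadingN16` (its `KeyedLive` guard and
the `N16LettersEnd ∕ N16RadiusMatch` rows are not read), `KeyedRatesHolderD4 β (rrOfRecord 𝔯 ksel)` — stub 1's rates conjunct — FOLLOWS from ONE `N16HolderAt … β` per guarded family at the
loose-data object + def-W1's four finite-volume kernel letters of record + the letter rows `Signs ∕ 0 < κ ∕ betaPrime510 4 1 κ ≤ cr ∕ 0 ≤ ρ < 1` ((Kꜰ) `pHolderD4Body_rateCarriers_of_kernels_pin` per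
tuple under `ForSmallCouplings.of_forall`): the located content of `stub_rates13H` beyond its pins.

CONTENTS.  §1 `SpineReading`, `RateReadingFn`, `RunSel`, `LetterReading`, `CutReading`, `rrOfRecord`, `PHolderD4`, `KeyedRatesHolderD4`, `KeyedSensitive` (displayed only, as in v4∕v5),
`N15PinnedSized`, `U3PinnedKernels`, `GuardedReading`, `N16RadiusMatch`, `GuardedReadingN16`, `guardedReading_of_n16`, `KeyedRelWeight`, `KeyedShellWeight`, `KeyedCoreEdgeHolderD4`,
`KeyedExtraction`, `LiveSel`, `PinnedAtLive` (v5 texts VERBATIM).  §2 `spineGivenEndpointR13SepCoPH_iff` (`Iff.rfl`) · `spineGivenEndpointR13SepCoPH_of_stubTexts` (the two v5 texts ⟹ K3⁷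
BY NAME; = the skeleton's composition).  §3 `u3PinnedKernels_iff` ∕ `n15PinnedSized_iff` (`Iff.rfl` faces to this seat's raw `hpin` ∕ `hpin2` binders) · ★★★
`keyedRatesHolderD4_rrOfRecord_of_pins_of_letters` (stub 1's rates conjunct at the pinned reading of record from `h16` + the four kernel letters + the letter rows) ·
`hybridNE7Under_of_guardedReadingN16_of_letters` ((Kᴸᴾ) `hybridNE7Under_of_v5pins_fsc_of_letters` keyed on `GuardedReadingN16` BY NAME: K3⁷'s body per guarded admissible tuple from the
pinned reading + `h16` + letters + letter rows + stub 2's four faces at a `cr`).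

HONEST FRAMING.  Definitions (texts mirrored, nothing new asserted), one `Iff.rfl`, one by-name composition, and bookkeeping theorems whose every estimate row is a DISPLAYED HYPOTHESIS
inhabited for no family today (K0⁷ OPEN): the four kernel letters (finite-volume statements of Bałaban-type SHAPE, NOT PRINTED as such for d = 4; (1.21)'s existence [I] p. 264 NOT proved;
(5.10) = [I] p. 293 before the limit), THE END's N16 sentence at the loose-data object, NE7-cluster, the N19′ face; the N14 ∕ N15 pins point at a datum-read tower ∕ a MODEL-level family
(v5's own labels); NOTHING of Bałaban asserted or instantiated; no stub is proved here; K3⁷ stmt-QuantumFields-20544 OPEN, unclaimed; the skeleton of record is the plan's v5 (this file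
neither replaces nor re-registers it — it mirrors its texts so that proofs can be filed by name; if the plan re-cuts, this file is superseded, not edited).  Counts unmoved (typed 28∕28 ·
discharged 5∕27, A 5∕28).  One finite 𝕋⁴ programme at fixed `ε`, Bałaban AS PRINTED — R4 closes the CONDITIONAL finite-𝕋⁴ rung `BalabanLadder.UV` only: NOT continuum ∕ ℝ⁴ ∕ OS ∕
mass gap ∕ Clay; the Yang–Mills mass gap is NOT proved by any of this.  No `sorry`, `instance`, `notation`; standard axioms.
-/

noncomputable section

open scoped Matrix.Norms.L2Operator

namespace Summit.QuantumFields.YangMills.Theorems.K3V5Defs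

open Literature.MathematicalPhysics.QuantumFieldTheory.Balaban1983to89
open Literature.MathematicalPhysics.QuantumFieldTheory.Balaban1983to89.T4Continuum
open Literature.MathematicalPhysics.QuantumFieldTheory.Balaban1983to89.B12Sec2to5 (betaPrime510)
open Literature.MathematicalPhysics.QuantumFieldTheory.Balaban1983to89.Node00.U3OfKernels (objectsOfRecord₁₃ KernelDecayOfRecord₁₃)
open Literature.MathematicalPhysics.QuantumFieldTheory.Balaban1983to89.Node00.U3KernelLetters (PolLimitsExistOfRecord₁₃ WindowedNE9OfRecord₁₃ WindowedDecayOfRecord₁₃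
  WindowedStepRateOfRecord₁₃)
open T4WeightBudget (RelWeightBound)
open T4IndicatorShell (ShellWeightBound)
open T4ContinuumYM4Torus (ForSmallCouplings)
open T4ApexHybrid (HybridNE7Under)
open Summit.QuantumFields.BalabanUV.T4Continuum
open Summit.QuantumFields.BalabanUV.T4Continuum.Spine
open MinimalActionRate (sfClass)
open YMDAG.UVSplit
open YMDAG.N14.TopBorn (Ne1PinnedOfRecord)
open YMDAG.N18.U3Guards (SensitiveOnBoxes)
open Node00 (Stage13HParams datumOfRecord₁₃CoPH U3Letters₁₁ NE3Letters₁₁ ne3ConstLayerOfRecord₁₁ ne3NperOfRecord₁₁ ne3DomOfRecord₁₁)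
open Summit.QuantumFields.YangMills.BalabanUVNodes.N16HolderDefs (N16HolderAt)
open Summit.QuantumFields.YangMills.BalabanUVNodes.N16PinnedLayer13CoPH (N16PinnedLoose N16LettersEnd)
open Summit.QuantumFields.YangMills.BalabanUVNodes.N15.PairedFamilyGuard (KeyedLive)
open Summit.QuantumFields.YangMills.BalabanUVNodes.N15.GenuineRecord (fullGSizedObjects)
open Summit.QuantumFields.YangMills.BalabanUVNodes.N15.AtKeyedHome (neZero_blockFactor)
open Summit.QuantumFields.YangMills.BalabanUVNodes.SpineRatesHolder (RatesHolderAt)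
open Summit.QuantumFields.YangMills.BalabanUVNodes.N19CoreEdgeFSCComposer (keyedGuarded₁₃CoPH_of_keyedFacesP_fsc)
open Summit.QuantumFields.YangMills.Theorems.BalabanUVNodesN27SpineRecord (hybridNE7Under_of_v5pins_fsc_of_letters pHolderD4Body_rateCarriers_of_kernels_pin
  n22At_kernels_of_letters_guarded n18At_kernels_of_letters_guarded kernelDecayOfRecord₁₃_of_letters_guarded)

/-! ## §1 The v5 predicate texts, verbatim (K3⁷ skeleton v5 941dddb108cbaacf §1 ∕ §1b ∕ §1c) -/

/-- a READING of spine carriers off the Stage-13 tuples with core provisos — dag-n20-d's `SpineReading₁₃CoPH 2` BY NAME (v5 l.209). [bookkeeping] -/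
abbrev SpineReading : Type 1 := SpineReading₁₃CoPH 2

/-- a READING of rate carriers off the Stage-13 tuples with core provisos (v5 l.212). [bookkeeping] -/
abbrev RateReadingFn : Type _ :=
  (F : T4Family) → (θ : Stage13HParams F 2) → θ.Provisos₁₃CoPH F 2 → (ℕ → ℝ) → List (ULoop F) → RateCarriers 2

/-- a RUN-LENGTH SELECTOR (v5 l.216). [bookkeeping] -/
abbrev RunSel : Type _ :=
  (F : T4Family) → (θ : Stage13HParams F 2) → θ.Provisos₁₃CoPH F 2 → (ℕ → ℝ) → List (ULoop F) → ℕ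

/-- a LETTER-BLOCK READING: node U3's K-uniform letters read at `(F, θ)` (v5 l.220; the `ℓ F θ` of the three producer files and of this seat's `hpin`). [bookkeeping] -/
abbrev LetterReading : Type _ :=
  (F : T4Family) → Stage13HParams F 2 → U3Letters₁₁

/-- a CUT-POLICY READING: the large-field cut depth read PER TUPLE (v5 l.224). [bookkeeping] -/
abbrev CutReading : Type _ :=
  (F : T4Family) → (θ : Stage13HParams F 2) → θ.Provisos₁₃CoPH F 2 → (ℕ → ℝ) → List (ULoop F) → ℕ → ℕ

/-- **THE RATE READING OF RECORD** read from `𝔯` at the selected run length (v5 l.229). [bookkeeping] -/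
def rrOfRecord (𝔯 : RateReading₁₃CoPH 2) (ksel : RunSel) : RateReadingFn :=
  fun F θ hP g₀ os => rateCarriersOfRecord₁₃CoPH 𝔯 F θ hP g₀ os (ksel F θ hP g₀ os)

/-- **THE v2 RATES PREDICATE** `R-β rates ∧ (D4) read-out ∧ node U3's rate letter in [0,1[` (v5 l.234; dag-n16-e `RatesHolderAt`, `ReadOutAt`).
[cite: Balaban1985RegularSpaces, (1.36) p.82 (the Hölder exponent); Balaban1987RG1, (1.20)–(1.22) p.264 (the read-out)] [bookkeeping] -/
def PHolderD4 (β : ℝ) {F : T4Family} (D : Datum F 2) (R : RateCarriers 2) : Prop :=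
  RatesHolderAt D R β ∧ ReadOutAt D R.u3 ∧ (0 ≤ R.u3.ρ ∧ R.u3.ρ < 1)

/-- K4 (v4∕v5 (t9)∕№204) · the R-β rates with (D4) AT THE READING OF RECORD under the crux's own prefix `(B) → END → ForSmallCouplings D` (v5 l.240; [I] Thm 2 p.259: the TUNED sequences).
[cite: Balaban1987RG1, Thm 2 p.259] [bookkeeping] -/
def KeyedRatesHolderD4 (β : ℝ) (rr : RateReadingFn) : Prop :=
  ∀ (F : T4Family) (θ : Stage13HParams F 2) (hP : θ.Provisos₁₃CoPH F 2), (θ.ZhUnity F 2 ∧ θ.SlotsNondegenerate₁₃ F 2) → θ.Admissible F 2 →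
    B16.EndStatementBPrinted (datumOfRecord₁₃CoPH F 2 θ hP).C → DagBinding.EndpointExistence (datumOfRecord₁₃CoPH F 2 θ hP).C.toB12 →
      ForSmallCouplings (datumOfRecord₁₃CoPH F 2 θ hP) fun g₀ => ∀ os : List (ULoop F), PHolderD4 β (datumOfRecord₁₃CoPH F 2 θ hP) (rr F θ hP g₀ os)

/-- N18 ∕ node U3 keyed SENSITIVITY predicate — DISPLAYED ONLY, not a conjunct of the guard (v4∕v5 № 13; v5 l.251). [bookkeeping] -/
def KeyedSensitive (𝔯 : RateReading₁₃CoPH 2) (ksel : RunSel) : Prop :=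
  ∀ (F : T4Family) (θ : Stage13HParams F 2) (hP : θ.Provisos₁₃CoPH F 2), (θ.ZhUnity F 2 ∧ θ.SlotsNondegenerate₁₃ F 2) → θ.Admissible F 2 →
    ∀ (g₀ : ℕ → ℝ) (os : List (ULoop F)),
      SensitiveOnBoxes (rrOfRecord 𝔯 ksel F θ hP g₀ os).u3.EA (rrOfRecord 𝔯 ksel F θ hP g₀ os).u3.γ

/-- **(α-N15) THE N15 PIN, MODEL LEVEL** — the reading's N15 objects ARE dag-n15-a's SIZED GENUINE objects (v5 l.260). [cite: Balaban1984PropagatorsI, (3.42) (bookkeeping)] -/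
def N15PinnedSized (𝔯 : RateReading₁₃CoPH 2) : Prop :=
  ∃ (b aS : ℝ) (ν μ α β : Fin 4) (c35 p : ℝ), 0 < b ∧ 0 < aS ∧
    ∀ (F : T4Family) (θ : Stage13HParams F 2) (hP : θ.Provisos₁₃CoPH F 2) (g₀ : ℕ → ℝ) (os : List (ULoop F)) (k : ℕ),
      (𝔯.lit F θ hP g₀ os).ne2 k = haveI := neZero_blockFactor F; fullGSizedObjects 3 F.hL b aS ν μ α β c35 p

/-- **(t-U3) THE NODE-U3 PIN** — node U3's objects ARE def-W1's kernel objects of record at the letter block `ℓ F θ` (v5 l.268; W1-19 p590183; the `hpin` of the producer files and of this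
seat's lineage VERBATIM). [cite: Balaban1987RG1, (1.20)–(1.22) p.264 (bookkeeping)] -/
def U3PinnedKernels (𝔯 : RateReading₁₃CoPH 2) (ℓ : LetterReading) : Prop :=
  ∀ (F : T4Family) (θ : Stage13HParams F 2) (hP : θ.Provisos₁₃CoPH F 2) (g₀ : ℕ → ℝ) (os : List (ULoop F)),
    (𝔯.lit F θ hP g₀ os).u3 = objectsOfRecord₁₃ F 2 θ.toStage13Params (ℓ F θ)

/-- **THE PINNED READING WITH ONE GUARD** (v4; v5 l.283): the N14 pin `Ne1PinnedOfRecord 𝔯`, N15's keyed liveness at the selected level, the (α-N15) pin, the node-U3 pin. [bookkeeping] -/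
def GuardedReading (𝔯 : RateReading₁₃CoPH 2) (ksel : RunSel) (ℓ : LetterReading) : Prop :=
  Ne1PinnedOfRecord 𝔯 ∧ KeyedLive (rrOfRecord 𝔯 ksel) ∧ N15PinnedSized 𝔯 ∧ U3PinnedKernels 𝔯 ℓ

/-- **THE RADIUS MATCH ROW** (v5 l.289): `0 < B F` and `(ℓ₃ F).ε / B F ≤ (ℓ₃ F).b`. [cite: Balaban1985Variational, Thm 1 (7) p.279 (the radius; bookkeeping)] -/
def N16RadiusMatch (ℓ₃ : T4Family → Node00.NE3Letters₁₁) (B : T4Family → ℝ) : Prop :=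
  ∀ F : T4Family, 0 < B F ∧ (ℓ₃ F).ε / B F ≤ (ℓ₃ F).b

/-- **THE PINNED READING WITH NODE N16's LAYER PINNED LOOSE** (v5 (t-N16), l.295): v4's `GuardedReading` ∧ `N16PinnedLoose 𝔯 ℓ₃ B` ∧ `N16LettersEnd 2 g ℓ₃` ∧ `N16RadiusMatch ℓ₃ B`. [bookkeeping] -/
def GuardedReadingN16 (𝔯 : RateReading₁₃CoPH 2) (ksel : RunSel) (ℓ : LetterReading) (ℓ₃ : T4Family → Node00.NE3Letters₁₁) (g B : T4Family → ℝ) : Prop :=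
  GuardedReading 𝔯 ksel ℓ ∧ N16PinnedLoose 𝔯 ℓ₃ B ∧ N16LettersEnd 2 g ℓ₃ ∧ N16RadiusMatch ℓ₃ B

/-- v5: the N16-pinned reading IS a v4 guarded reading (v5 l.299). [bookkeeping] -/
theorem guardedReading_of_n16 {𝔯 : RateReading₁₃CoPH 2} {ksel : RunSel} {ℓ : LetterReading} {ℓ₃ : T4Family → Node00.NE3Letters₁₁} {g B : T4Family → ℝ}
    (h : GuardedReadingN16 𝔯 ksel ℓ ℓ₃ g B) : GuardedReading 𝔯 ksel ℓ := h.1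

/-- N20 · NE7b `RelWeightBound` at the spine reading (v5 l.315; leaf D's `h20` shape). [cite: Balaban1988Convergent, (3.23) p.270 (the relative weights; bookkeeping)] -/
def KeyedRelWeight (cr : SpineReading) : Prop :=
  ∀ (F : T4Family) (θ : Stage13HParams F 2) (hP : θ.Provisos₁₃CoPH F 2), (θ.ZhUnity F 2 ∧ θ.SlotsNondegenerate₁₃ F 2) → θ.Admissible F 2 →
    ∀ (g₀ : ℕ → ℝ) (os : List (ULoop F)),
      RelWeightBound (cr F θ hP g₀ os).l₀ (cr F θ hP g₀ os).T (cr F θ hP g₀ os).A (cr F θ hP g₀ os).B (cr F θ hP g₀ os).Bad (cr F θ hP g₀ os).W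

/-- N21 · NE7c `ShellWeightBound` at the spine reading (v5 l.321; leaf D's `h21` shape). [cite: Balaban1988RG2Cluster, (2.14) p.15 (the shells; bookkeeping)] -/
def KeyedShellWeight (cr : SpineReading) : Prop :=
  ∀ (F : T4Family) (θ : Stage13HParams F 2) (hP : θ.Provisos₁₃CoPH F 2), (θ.ZhUnity F 2 ∧ θ.SlotsNondegenerate₁₃ F 2) → θ.Admissible F 2 →
    ∀ (g₀ : ℕ → ℝ) (os : List (ULoop F)),
      ShellWeightBound (cr F θ hP g₀ os).l₀ (cr F θ hP g₀ os).T (cr F θ hP g₀ os).A (cr F θ hP g₀ os).B (cr F θ hP g₀ os).shA (cr F θ hP g₀ os).shB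
        (cr F θ hP g₀ os).Wsh

/-- N19′ (v4∕v5 (t9)∕№204) · the NE7 core matching with SOME summable `δ`, GIVEN the rates, under the crux's prefix (v5 l.331; dag-n19-w3's `h19` shape at `P := PHolderD4 β`).
[cite: Balaban1987RG1, Thm 2 p.259 (bookkeeping)] -/
def KeyedCoreEdgeHolderD4 (β : ℝ) (cr : SpineReading) (rr : RateReadingFn) : Prop :=
  ∀ (F : T4Family) (θ : Stage13HParams F 2) (hP : θ.Provisos₁₃CoPH F 2), (θ.ZhUnity F 2 ∧ θ.SlotsNondegenerate₁₃ F 2) → θ.Admissible F 2 →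
    B16.EndStatementBPrinted (datumOfRecord₁₃CoPH F 2 θ hP).C → DagBinding.EndpointExistence (datumOfRecord₁₃CoPH F 2 θ hP).C.toB12 →
      ForSmallCouplings (datumOfRecord₁₃CoPH F 2 θ hP) fun g₀ => ∀ os : List (ULoop F),
        PHolderD4 β (datumOfRecord₁₃CoPH F 2 θ hP) (rr F θ hP g₀ os) → letI := (cr F θ hP g₀ os).dec
          ∃ δ : ℕ → ℝ, NE7.Core (cr F θ hP g₀ os).l₀ (cr F θ hP g₀ os).vol (cr F θ hP g₀ os).T (cr F θ hP g₀ os).Bad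
            (fun K t τ => (cr F θ hP g₀ os).A K t τ - (cr F θ hP g₀ os).shA K t τ) (fun K t τ => (cr F θ hP g₀ os).B K t τ - (cr F θ hP g₀ os).shB K t τ) δ ∧
            Summable δ

/-- N27x · extraction at the spine reading (v5 l.341; leaf D's `hx` shape). [cite: Balaban1988Convergent, (3.23) p.270 (the representation; bookkeeping)] -/
def KeyedExtraction (cr : SpineReading) : Prop :=
  ∀ (F : T4Family) (θ : Stage13HParams F 2) (hP : θ.Provisos₁₃CoPH F 2), (θ.ZhUnity F 2 ∧ θ.SlotsNondegenerate₁₃ F 2) → θ.Admissible F 2 →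
    B16.EndStatementBPrinted (datumOfRecord₁₃CoPH F 2 θ hP).C → DagBinding.EndpointExistence (datumOfRecord₁₃CoPH F 2 θ hP).C.toB12 →
      ForSmallCouplings (datumOfRecord₁₃CoPH F 2 θ hP) fun g₀ => ∀ os : List (ULoop F),
        0 < (cr F θ hP g₀ os).l₀ ∧ 0 < (cr F θ hP g₀ os).vol ∧
        (∀ (K : ℕ) (t : ℝ), |t| ≤ (cr F θ hP g₀ os).l₀ →
          T4GenFunBounds.schemeZ ((datumOfRecord₁₃CoPH F 2 θ hP).scheme g₀) os ((cr F θ hP g₀ os).K₀ + K) t =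
            ∑ τ ∈ (cr F θ hP g₀ os).T K, (cr F θ hP g₀ os).A K t τ) ∧
        (∀ (K : ℕ) (t : ℝ), |t| ≤ (cr F θ hP g₀ os).l₀ →
          T4GenFunBounds.schemeZ ((datumOfRecord₁₃CoPH F 2 θ hP).scheme g₀) os ((cr F θ hP g₀ os).K₀ + K + 1) t =
            ∑ τ ∈ (cr F θ hP g₀ os).T K, (cr F θ hP g₀ os).B K t τ)

/-- **THE LIVE-SELECTOR LINE** (v5 l.357). [bookkeeping] -/
def LiveSel (F : T4Family) (θ : Stage13HParams F 2) : Prop :=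
  θ.ppSel = Node00.ppSelLiveOfRecord F 2 θ.ν θ.τ9 (Node00.EOfRecord₁₃ F 2 θ.toStage13Params) (Node00.wOfRecord₉ F 2 θ.toStage9Params)

/-- **PINNED AT LIVE** (v3∕v5 l.363): on the live-selector line the spine reading IS dag-n20-d's `crOfRecord₁₃V (jc F θ hP g₀ os) sh`. [bookkeeping] -/
def PinnedAtLive (jc : CutReading) (sh : ShellSplit₁₃CoPH 2 0) (cr : SpineReading) : Prop :=
  ∀ (F : T4Family) (θ : Stage13HParams F 2) (hP : θ.Provisos₁₃CoPH F 2) (g₀ : ℕ → ℝ) (os : List (ULoop F)),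
    LiveSel F θ → cr F θ hP g₀ os = crOfRecord₁₃V (jc F θ hP g₀ os) sh F θ hP g₀ os

/-! ## §2 The `Iff.rfl` bridge to the route decl and the by-name composition (= the skeleton's `SpineGivenEndpointR13SepCoPH_of`) -/

/-- **K3⁷ ⟺ ITS BODY** (`Iff.rfl`): `SpineGivenEndpointR13SepCoPH` IS «for every guarded admissible Stage-13 tuple with separated-range provisos, (B) → END → `HybridNE7Under (datumOfRecord₁₃SepCoPH F 2 θ h) END`». [bookkeeping] -/
theorem spineGivenEndpointR13SepCoPH_iff :
    Summit.QuantumFields.YangMills.Theses.BalabanUVNodes.SpineGivenEndpointR13SepCoPH ↔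
      ∀ (F : T4Family) (θ : Stage13HParams F 2) (h : θ.Provisos₁₃SepCoPH F 2), (θ.ZhUnity F 2 ∧ θ.SlotsNondegenerate₁₃ F 2) → θ.Admissible F 2 →
        B16.EndStatementBPrinted (Node00.datumOfRecord₁₃SepCoPH F 2 θ h).C → DagBinding.EndpointExistence (Node00.datumOfRecord₁₃SepCoPH F 2 θ h).C.toB12 →
          HybridNE7Under (Node00.datumOfRecord₁₃SepCoPH F 2 θ h) (DagBinding.EndpointExistence (Node00.datumOfRecord₁₃SepCoPH F 2 θ h).C.toB12) :=
  Iff.rfl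

/-- **K3⁷ FROM THE TWO v5 STUB TEXTS, BY NAME** (= the skeleton's composition: stub 1 → stub 2 → one application per guarded admissible tuple of dag-n19-w3's FSC composer at
`G := ZhUnity ∧ SlotsNondegenerate₁₃`, `P := PHolderD4 β`; `datumOfRecord₁₃SepCoPH F 2 θ h = datumOfRecord₁₃CoPH F 2 θ h.toCore` is `rfl`).  No stub is proved here. [bookkeeping] -/
theorem spineGivenEndpointR13SepCoPH_of_stubTexts
    (h₁ : ∃ β : ℝ, 2 / 3 < β ∧ β < 1 ∧ ∃ (𝔯 : RateReading₁₃CoPH 2) (ksel : RunSel) (ℓ : LetterReading) (ℓ₃ : T4Family → Node00.NE3Letters₁₁) (g B : T4Family → ℝ),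
      GuardedReadingN16 𝔯 ksel ℓ ℓ₃ g B ∧ KeyedRatesHolderD4 β (rrOfRecord 𝔯 ksel))
    (h₂ : ∀ β : ℝ, 2 / 3 < β → β < 1 → ∀ (𝔯 : RateReading₁₃CoPH 2) (ksel : RunSel) (ℓ : LetterReading) (ℓ₃ : T4Family → Node00.NE3Letters₁₁) (g B : T4Family → ℝ),
      GuardedReadingN16 𝔯 ksel ℓ ℓ₃ g B → KeyedRatesHolderD4 β (rrOfRecord 𝔯 ksel) →
      ∃ (jc : CutReading) (sh : ShellSplit₁₃CoPH 2 0) (cr : SpineReading), PinnedAtLive jc sh cr ∧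
        KeyedRelWeight cr ∧ KeyedShellWeight cr ∧ KeyedExtraction cr ∧ KeyedCoreEdgeHolderD4 β cr (rrOfRecord 𝔯 ksel)) :
    Summit.QuantumFields.YangMills.Theses.BalabanUVNodes.SpineGivenEndpointR13SepCoPH := by
  obtain ⟨β, hβ, hβ', 𝔯, ksel, ℓ, ℓ₃, g, B, hg, hr⟩ := h₁
  obtain ⟨_jc, _sh, cr, -, h20, h21, hx, h19⟩ := h₂ β hβ hβ' 𝔯 ksel ℓ ℓ₃ g B hg hr
  exact fun F θ hP hG hθ _ _ =>
    keyedGuarded₁₃CoPH_of_keyedFacesP_fsc cr (rrOfRecord 𝔯 ksel) (fun θ => θ.ZhUnity _ 2 ∧ θ.SlotsNondegenerate₁₃ _ 2) (PHolderD4 β) h20 h21 hr h19 hx F θ hP.toCore hG hθ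

/-! ## §3 The kernel-pinned bill of stub 1's rates conjunct, in the mirrored names (this seat's lineage) -/

/-- Face (`Iff.rfl`): the node-U3 pin IS this seat's raw `hpin` binder. [bookkeeping] -/
theorem u3PinnedKernels_iff (𝔯 : RateReading₁₃CoPH 2) (ℓ : LetterReading) :
    U3PinnedKernels 𝔯 ℓ ↔ ∀ (F : T4Family) (θ : Stage13HParams F 2) (hP : θ.Provisos₁₃CoPH F 2) (g₀ : ℕ → ℝ) (os : List (ULoop F)),
      (𝔯.lit F θ hP g₀ os).u3 = objectsOfRecord₁₃ F 2 θ.toStage13Params (ℓ F θ) :=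
  Iff.rfl

/-- Face (`Iff.rfl`): stub 1's rates conjunct IS the FSC-keyed `PHolderD4 β` family at the selected bundles. [bookkeeping] -/
theorem keyedRatesHolderD4_rrOfRecord_iff (β : ℝ) (𝔯 : RateReading₁₃CoPH 2) (ksel : RunSel) :
    KeyedRatesHolderD4 β (rrOfRecord 𝔯 ksel) ↔
      ∀ (F : T4Family) (θ : Stage13HParams F 2) (hP : θ.Provisos₁₃CoPH F 2), (θ.ZhUnity F 2 ∧ θ.SlotsNondegenerate₁₃ F 2) → θ.Admissible F 2 →
        B16.EndStatementBPrinted (datumOfRecord₁₃CoPH F 2 θ hP).C → DagBinding.EndpointExistence (datumOfRecord₁₃CoPH F 2 θ hP).C.toB12 →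
          ForSmallCouplings (datumOfRecord₁₃CoPH F 2 θ hP) fun g₀ => ∀ os : List (ULoop F),
            RatesHolderAt (datumOfRecord₁₃CoPH F 2 θ hP) (rateCarriersOfRecord₁₃CoPH 𝔯 F θ hP g₀ os (ksel F θ hP g₀ os)) β ∧
              ReadOutAt (datumOfRecord₁₃CoPH F 2 θ hP) (rateCarriersOfRecord₁₃CoPH 𝔯 F θ hP g₀ os (ksel F θ hP g₀ os)).u3 ∧
              (0 ≤ (rateCarriersOfRecord₁₃CoPH 𝔯 F θ hP g₀ os (ksel F θ hP g₀ os)).u3.ρ ∧ (rateCarriersOfRecord₁₃CoPH 𝔯 F θ hP g₀ os (ksel F θ hP g₀ os)).u3.ρ < 1) :=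
  Iff.rfl

section Bill

variable (𝔯 : RateReading₁₃CoPH 2) (ksel : RunSel) (ℓ : LetterReading) (ℓ₃ : T4Family → Node00.NE3Letters₁₁) (g B : T4Family → ℝ) (β : ℝ)
  (s : (F : T4Family) → Stage13HParams F 2 → ℕ)
  (hG : GuardedReadingN16 𝔯 ksel ℓ ℓ₃ g B)
  -- N16 at exponent β at the LOOSE-DATA object, one sentence per guarded family (THE END's content; module 43 §4 ∕ p602214 supply it)
  (h16 : ∀ (F : T4Family), (∃ θ : Stage13HParams F 2, θ.Provisos₁₃CoPH F 2 ∧ (θ.ZhUnity F 2 ∧ θ.SlotsNondegenerate₁₃ F 2) ∧ θ.Admissible F 2) →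
    N16HolderAt (ne3OfRecord₁₁ F { ne3ConstLayerOfRecord₁₁ F 2 (ℓ₃ F) with
      dom := {V | V ∈ ne3DomOfRecord₁₁ F 2 0 0 ∧ V ∈ sfClass 4 F.L (ne3NperOfRecord₁₁ F 0 0) ((ℓ₃ F).ε / B F) 0} }) β)
  -- the U3 letter block's rows
  (hs : ∀ (F : T4Family) (θ : Stage13HParams F 2), θ.Provisos₁₃CoPH F 2 → (θ.ZhUnity F 2 ∧ θ.SlotsNondegenerate₁₃ F 2) → θ.Admissible F 2 → (ℓ F θ).Signs)
  (hκ : ∀ (F : T4Family) (θ : Stage13HParams F 2), θ.Provisos₁₃CoPH F 2 → (θ.ZhUnity F 2 ∧ θ.SlotsNondegenerate₁₃ F 2) → θ.Admissible F 2 → 0 < (ℓ F θ).κ)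
  (hcr : ∀ (F : T4Family) (θ : Stage13HParams F 2), θ.Provisos₁₃CoPH F 2 → (θ.ZhUnity F 2 ∧ θ.SlotsNondegenerate₁₃ F 2) → θ.Admissible F 2 → betaPrime510 4 1 (ℓ F θ).κ ≤ (ℓ F θ).cr)
  (hρ : ∀ (F : T4Family) (θ : Stage13HParams F 2), θ.Provisos₁₃CoPH F 2 → (θ.ZhUnity F 2 ∧ θ.SlotsNondegenerate₁₃ F 2) → θ.Admissible F 2 → 0 ≤ (ℓ F θ).ρ ∧ (ℓ F θ).ρ < 1)
  -- def-W1's four finite-volume kernel letters of record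
  (hL : ∀ (F : T4Family) (θ : Stage13HParams F 2), θ.Provisos₁₃CoPH F 2 → (θ.ZhUnity F 2 ∧ θ.SlotsNondegenerate₁₃ F 2) → θ.Admissible F 2 → PolLimitsExistOfRecord₁₃ F 2 θ.toStage13Params)
  (h9 : ∀ (F : T4Family) (θ : Stage13HParams F 2), θ.Provisos₁₃CoPH F 2 → (θ.ZhUnity F 2 ∧ θ.SlotsNondegenerate₁₃ F 2) → θ.Admissible F 2 →
    WindowedNE9OfRecord₁₃ F 2 θ.toStage13Params (ℓ F θ).κ (ℓ F θ).moduli)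
  (hW : ∀ (F : T4Family) (θ : Stage13HParams F 2), θ.Provisos₁₃CoPH F 2 → (θ.ZhUnity F 2 ∧ θ.SlotsNondegenerate₁₃ F 2) → θ.Admissible F 2 →
    WindowedDecayOfRecord₁₃ F 2 θ.toStage13Params 0 1 (ℓ F θ).κ)
  (hS : ∀ (F : T4Family) (θ : Stage13HParams F 2), θ.Provisos₁₃CoPH F 2 → (θ.ZhUnity F 2 ∧ θ.SlotsNondegenerate₁₃ F 2) → θ.Admissible F 2 →
    WindowedStepRateOfRecord₁₃ F 2 θ.toStage13Params (s F θ) (ℓ F θ).κ (ℓ F θ).θ₅ ((ℓ F θ).C₅ * (ℓ F θ).θ₅))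
include hG h16 hs hκ hcr hρ hL h9 hW hS

/-- ★★★ **STUB 1's RATES CONJUNCT AT THE PINNED READING OF RECORD FROM THE ROWS**: GIVEN `GuardedReadingN16 𝔯 ksel ℓ ℓ₃ g B` (only its four PINS are read), `KeyedRatesHolderD4 β (rrOfRecord 𝔯 ksel)` follows from
ONE `N16HolderAt … β` per guarded family at the loose-data object, def-W1's four kernel letters and the letter rows — per tuple by (Kꜰ) `pHolderD4Body_rateCarriers_of_kernels_pin` (N14 ∕ N15 outright behind
the pins, N22 ∕ N18 ∕ (D4) off the letters via (Kᴸ) §1, N17 by the U3 → U2 edge), lifted under the prefix by `ForSmallCouplings.of_forall` (the rows hold at EVERY `g₀`).  The located content of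
`stub_rates13H` beyond its pins and guard; every row a HYPOTHESIS; NOT a proof of the stub (no `∃ 𝔯`, no `KeyedLive`, no window). [bookkeeping] -/
theorem keyedRatesHolderD4_rrOfRecord_of_pins_of_letters : KeyedRatesHolderD4 β (rrOfRecord 𝔯 ksel) := by
  obtain ⟨⟨hpin1, -, hpin2, hpin⟩, hpinL, -, -⟩ := hG
  obtain ⟨b, aS, ν, μ, α, β', c35, p, hb, haS, h2⟩ := hpin2
  intro F θ hP hGd hθ _ _
  refine ForSmallCouplings.of_forall fun g₀ os => ?_
  refine pHolderD4Body_rateCarriers_of_kernels_pin 𝔯 θ hP g₀ os (ℓ F θ) (hpin F θ hP g₀ os) β (ksel F θ hP g₀ os)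
    (YMDAG.N14.TopBorn.n14At_rateCarriersOfRecord₁₃CoPH_of_pinned 𝔯 hpin1 F θ hP g₀ os (ksel F θ hP g₀ os)) ?_ ?_
    (hs F θ hP hGd hθ) (hκ F θ hP hGd hθ) (hcr F θ hP hGd hθ) (hρ F θ hP hGd hθ)
    (kernelDecayOfRecord₁₃_of_letters_guarded (fun F θ => θ.ZhUnity F 2 ∧ θ.SlotsNondegenerate₁₃ F 2) ℓ hL hW F θ hP hGd hθ)
    (n18At_kernels_of_letters_guarded (fun F θ => θ.ZhUnity F 2 ∧ θ.SlotsNondegenerate₁₃ F 2) ℓ s hL hS F θ hP hGd hθ _)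
    (n22At_kernels_of_letters_guarded (fun F θ => θ.ZhUnity F 2 ∧ θ.SlotsNondegenerate₁₃ F 2) ℓ hs hL h9 F θ hP hGd hθ _)
  · rw [h2 F θ hP g₀ os]
    exact Summit.QuantumFields.YangMills.BalabanUVNodes.N15.GenuineRecord.n15At_fullGSizedObjects_family hb haS ν μ α β' c35 p F
  · show N16HolderAt (rateCarriersOfRecord₁₃CoPH 𝔯 F θ hP g₀ os (ksel F θ hP g₀ os)).ne3 β
    rw [Summit.QuantumFields.YangMills.BalabanUVNodes.N16PinnedLayer13CoPH.rateCarriers_ne3_of_pinnedLoose hpinL]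
    exact h16 F ⟨θ, hP, hGd, hθ⟩

end Bill

end Summit.QuantumFields.YangMills.Theorems.K3V5Defs

end
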